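import Mathlib.Order.LiminfLimsup
import Mathlib.Analysis.SpecialFunctions.Log.Basic
import Literature.Analysis.FluidPDE.ClassicalSolution
import Literature.Analysis.FluidPDE.LerayHopf
import Literature.Analysis.FluidPDE.SuitableWeak
import Literature.Analysis.FluidPDE.SelfSimilar
import HarnessLib
import HarnessLib.Audit

-- provenance: harness21/H21/H21/Statements/NS/PartialRegularity.lean @ e53059b (interim HEAD d8f2665); M5 mechanical rewrite
/-!
# Partial regularity of suitable weak solutions of the Navier–Stokes equations
(family: NS, statements **ns.S10**, **ns.S11**, **ns.S12**, **ns.S23**, **ns.S32**; trunk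
FluidKinetic, outline `H21/Outlines/FluidKinetic.md`, item `NSPartialRegularity`; namespace
`Literature.NS`)

Physical space is `ℝ³ = EuclideanSpace ℝ (Fin 3)`; space–time points are `z = (t, x) : ℝ × ℝ³`
(time first) and velocities are `u : ℝ → ℝ³ → ℝ³`. All the vocabulary is the accepted prelude
`Prelude/FluidKinetic/SuitableWeak` (`Fluid.IsSuitableWeakSolutionOn`, `Fluid.parabolicCylinder`,
`Fluid.parabolicCylinderCentered`, `Fluid.HasWeakSpatialGradientOn`, `Fluid.cknA/E/C/D`,
`Fluid.IsRegularPoint`, `Fluid.singularSet`, `Fluid.IsParabolicNull`), `SelfSimilar`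
(`Fluid.IsBoundedAncientMildSolution`), `ClassicalSolution` (`Fluid.IsClassicalNSSolutionOn`),
`MildSolution` (`Fluid.IsBoundedOn`), `WeakSolution` (`Fluid.slab`, `Fluid.IsSpaceTimeTestOn`) and
`VectorCalculus` (`Fluid.frobeniusNormSq`).

## Contents

* **ns.S10** (definition re-export): `NS.isSuitableWeakSolutionOn_def` unfolds the accepted
  structure `Fluid.IsSuitableWeakSolutionOn Q ν f u p` (CKN 1982, (2.1)–(2.5); Lin 1998, Def. 1)
  into the conjunction of its four fields, and `NS.parabolicCylinder_eq` records
  `Q_r(t, x) = (t - r², t) × B_r(x)`.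
* **ns.S11** `NS.ckn_partial_regularity` (CKN 1982, Theorem B): the singular set of a suitable
  weak solution has vanishing one-dimensional parabolic Hausdorff measure, `𝒫¹(S) = 0`.
* **ns.S12** `NS.ckn_epsilon_regularity` (CKN 1982, Proposition 2; Lin 1998, Thm 1.1): there is
  an absolute `ε > 0` such that `limsup_{r → 0} r⁻¹ ∫∫_{Q*_r(z)} |∇u|² ≤ ε` implies that `z` is a
  regular point.
* **ns.S23** (Albritton–Barker 2019, Thm 1.1): the named fact formerly stated here,
  `albritton_barker : TypeISingularityExists ↔ NontrivialTypeIAncientExists`, was RETIRED as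
  misstated (verdict clean-up, 2026-08-14; see "Retired and re-labelled" below). The corrected
  rendering of Thm 1.1 over the printed notions is
  `Literature.Analysis.FluidPDE.AlbrittonBarkerTypeICharacterization` (`LocalTypeI.lean`; proofs
  in `LocalTypeICharacterization.lean`, `LocalTypeIReverse.lean`). What remains in this file is
  vocabulary — `cknSum` (the accepted `A + C + D + E`), the centred Type I predicate
  `IsTypeISingularPoint` — and the two sides of the old equivalence as registered OPEN
  statements `TypeISingularityExists`, `NontrivialTypeIAncientExists` (`[status: open]`, not
  literature debt; the latter is used by `TypeIAncientLiouville.lean`).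
* **ns.S32** `NS.tao_quantitative_ess` (Tao 2021, Thm 1.2, `j = 0, 1`) and
  `NS.tao_L3_blowup_rate` (Tao 2021, Thm 1.4).

## Mathlib search

Mathlib (this pin) has no Navier–Stokes notion (`rg -i 'navier|suitable weak|parabolic cylinder|
Caffarelli'` in `Mathlib/`: no relevant hit; `Matrix.IsParabolic` is unrelated). Used from
Mathlib: `Filter.limsup`, `nhdsWithin` (`𝓝[>] 0`, `𝓝[<] T`), `Filter.Frequently`,
`MeasureTheory.eLpNorm`, `MeasureTheory.MemLp`, `iteratedFDeriv`, `Real.exp`, `Real.log`,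
`Real.rpow`, `TopologicalSpace.Opens`.

## Design notes

* **Dimension.** CKN, Lin, Albritton–Barker and Tao work on `ℝ³`; the exponents `q > 5/2`,
  `𝒫¹`, `t^{-(j+1)/2}` are dimension specific, so all target statements are specialised to
  `ℝ³ = EuclideanSpace ℝ (Fin 3)`. The ns.S10 re-export lemmas are stated for a general
  finite-dimensional inner product space `E`, as in the prelude.
* **Force hypotheses (ns.S11, ns.S12).** CKN 1982, (2.3′): `f ∈ L^q(D)` for some `q > 5/2` and
  `div f = 0` in `D`. Bundled as `NS.IsCKNForceOn Q f` (`MemLp (uncurry f) q (volume.restrict Q)`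
  for a real `q > 5/2`, and `∫∫ ⟪f, ∇φ⟫ = 0` for all space–time test functions on `Q`).
* **Centred cylinders in ns.S12.** CKN's Proposition 2 is stated with the *centred* cylinders
  `Q*_r(z)`, matching the accepted (centred) `Fluid.IsRegularPoint`; the accepted `Fluid.cknE` uses
  the backward cylinder `Q_r(z) ⊆ Q*_r(z)`, so the hypothesis of `ckn_epsilon_regularity` is
  written out with `parabolicCylinderCentered` (same normalisation `r⁻¹ ∫∫ |∇u|²`, `ℝ≥0∞`-valued,
  `limsup` taken in the complete lattice `ℝ≥0∞` along `𝓝[>] 0`). The viscosity is normalised to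
  `ν = 1` there so that `ε` is an absolute constant, as in CKN.
* **Weak gradients.** `∇u` enters through a weak spatial gradient `G` (`HasWeakSpatialGradientOn`),
  which is unique a.e. on `Q`; the scaled quantities `cknE r z G` and the centred variant only
  integrate `G` over cylinders inside `Q`, so quantifying `∀ G` or `∃ G` is immaterial.
* **Type I, centred form (ns.S23 vocabulary).** `IsTypeISingularPoint Q u p z` asks that `z` be a
  singular point (accepted, centred cylinders `Q*_r(z)`) of a suitable weak solution on `Q` with
  `sup_{0<r<r₀} (A + C + D + E)(r, z) < ∞` for some `r₀ > 0` with `Q_{r₀}(z) ⊆ Q`, the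
  quantities being the accepted `Fluid.cknA` (`sup_t`), `cknC`, `cknD` (`|p|^{3/2}`), `cknE` at
  cylinders **centred at `z` only** — a "some scale-invariant quantity stays bounded at the
  point" notion in the sense of Seregin–Šverák 2009, §1. This is NOT the Type I notion of
  Albritton–Barker 2019, §1, whose `𝐈(Q') = sup_{Q'' ⊂ Q'} (A + C + D + E)(Q'')` ranges over
  *all* parabolic sub-balls (any centre), with `esssup_t` in `A`, the mean-free pressure in `D`
  and backward balls in the notion of singular point; those printed notions are
  `IsLocalTypeISingularPoint`, `typeIBound`, `IsBackwardSingularPoint` of `LocalTypeI.lean`. On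
  the ancient side, `NontrivialTypeIAncientExists` bounds `sup_{r>0, z ∈ (-∞,0) × ℝ³}
  (A + C + D + E)(r, z)` (all balls in `ℝ³ × ℝ₋`, accepted quantities), where `p` is a pressure
  making `(u, p)` a suitable weak solution on `(-∞, 0) × ℝ³` and `G` a weak spatial gradient of
  `u` there; "nontrivial" is "not a.e. zero on `(-∞, 0) × ℝ³`". All suprema are in `ℝ≥0∞`, so
  `⨆ … < ∞` is honest.
* **Tao's classical solutions (ns.S32).** Tao 2021, §1 works with smooth solutions on
  `[0, T] × ℝ³` all of whose spatial derivatives are in `L^∞_t L²_x`; this is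
  `NS.IsHkClassicalSolutionOn S u p` (`Fluid.IsClassicalNSSolutionOn S 1 0 u p` plus uniform
  `L²` bounds on `iteratedFDeriv ℝ n (u t)`, `t ∈ S`, for every `n`). The critical bound
  `‖u‖_{L^∞_t L³_x} ≤ A` is written pointwise in `t` (`eLpNorm (u t) 3 volume ≤ A` for all
  `t ∈ [0, T]`), which for such solutions equals the essential supremum (lower semicontinuity of
  `t ↦ ‖u(t)‖₃`) and avoids the `toReal` junk of `Fluid.eLqLpNorm ∞ 3`. "Blow-up at `T`" in
  Thm 1.4 is `¬ Fluid.IsBoundedOn (Ico 0 T) u` (`‖u‖_{L^∞([0,T) × ℝ³)} = ∞`), and the conclusion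
  `limsup_{t → T⁻} ‖u(t)‖₃ / (log log log (T-t)⁻¹)^c = +∞` is phrased with `∃ᶠ t in 𝓝[<] T`,
  free of division conventions.

## Retired and re-labelled (verdict clean-up, 2026-08-14)

* `albritton_barker : TypeISingularityExists ↔ NontrivialTypeIAncientExists`
  (`[cite: AlbrittonBarker2019, Thm 1.1]`) — **retired as misstated**, declaration deleted (no
  module used it). Albritton–Barker 2019, §1 (arXiv:1811.00502, p. 3): "if there exists a parabolic
  ball `Q'` centered at the singular point `z` and `𝐈(Q') < ∞`, then we say that `z` is a Type I
  singularity", with `𝐈(ω) = sup_{Q' ⊂ ω} A(Q') + C(Q') + D(Q') + E(Q')` over **all** parabolic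
  balls `Q' ⊂ ω`, `A(Q') = esssup_{t-r²<t'<t} r⁻¹ ∫_{B(x,r)} |v|²`,
  `D(Q') = r⁻² ∫_{Q(z,r)} |q - [q]_{x,r}(t')|^{3/2}`, and "if `v` is not essentially bounded in any
  parabolic ball centered at `z` [backward balls `Q(z, r) = B(x, r) × ]t - r², t[`], we say that
  `z` is a singular point". The retired statement used `IsTypeISingularPoint` instead — bounds at
  the cylinders centred at `z` only, `sup_t` in `A`, `|p|^{3/2}` in `D`, centred cylinders in the
  notion of singular point — so its forward implication asserted more than the printed theorem,
  whose proof (§3: "This may require considering an earlier singularity than the original",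
  Prop. 2.4, followed by the Seregin–Šverák rescaling) uses the bound at balls not centred at `z`.
  Corrected rendering:
  `Literature.Analysis.FluidPDE.AlbrittonBarkerTypeICharacterization :=
  LocalTypeISingularityExists ↔ NontrivialMildAncientTypeIExists` (`LocalTypeI.lean`).
* `NontrivialTypeIAncientExists`, `TypeISingularityExists` — the two sides of the retired
  equivalence are existence statements that are **open** (a witness of the first is a Type I
  blow-up profile, a witness of the second a singular suitable weak solution of the unforced
  three-dimensional Navier–Stokes equations; "many questions concerning feasible Type I
  scenarios … remain completely open", A–B §1). The Liouville conjecture (L) of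
  Koch–Nadirashvili–Seregin–Šverák 2009 would refute the first ("Together, `v ≡ const.` and
  `𝐈 < ∞` imply `v ≡ 0`", A–B §1; in tree up to a slice-measurability proviso,
  `TypeIAncientLiouville.lean`) and excludes Type I singularities in Albritton–Barker's sense
  ("If true, the conjecture excludes Type I singularities", A–B §1). Neither was ever a fact in
  print (the paper asserts only the equivalence); both are now registered OPEN statements:
  docstrings `OPEN CONJECTURE — …` with `[status: open]` (CONVENTIONS §4), names kept
  (`NontrivialTypeIAncientExists` is used by `TypeIAncientLiouville.lean`; both are quoted in the
  `NavierStokesRegularity` route `TypeILiouville`). No `_holds` theorem is to be expected.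
* `IsTypeISingularPoint`, `cknSum` keep their bodies; their docstrings now say which (centred,
  accepted-quantity) notion they define.

## References

* L. Caffarelli, R. Kohn, L. Nirenberg, *Partial regularity of suitable weak solutions of the
  Navier–Stokes equations*, Comm. Pure Appl. Math. 35 (1982), 771–831: §2 (2.1)–(2.6),
  Proposition 2, Theorem B.
* F. Lin, *A new proof of the Caffarelli–Kohn–Nirenberg theorem*, Comm. Pure Appl. Math. 51
  (1998), 241–257, Def. 1, Thm 1.1.
* D. Albritton, T. Barker, *On local Type I singularities of the Navier–Stokes equations and
  Liouville theorems*, J. Math. Fluid Mech. 21 (2019), no. 43 (arXiv:1811.00502), Thm 1.1, (1.6).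
* T. Tao, *Quantitative bounds for critically bounded solutions to the Navier–Stokes equations*,
  Proc. Sympos. Pure Math. 104 (2021), 149–193 (arXiv:1908.04958), Thms 1.2, 1.4.
* G. Koch, N. Nadirashvili, G. Seregin, V. Šverák, *Liouville theorems for the Navier–Stokes
  equations and applications*, Acta Math. 203 (2009), §1.
* G. Seregin, V. Šverák, *On Type I singularities of the local axi-symmetric solutions of the
  Navier–Stokes equations*, Comm. PDE 34 (2009), 171–201 (arXiv:0804.1803), §1 ("Singularities
  for which some scale-invariant quantity is bounded are often called Type I singularities").
-/

noncomputable section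

open MeasureTheory Set Function Filter Topology TopologicalSpace Metric
open scoped Laplacian NNReal ENNReal InnerProductSpace RealInnerProductSpace

namespace Literature.Analysis.FluidPDE

/-- Local notation for physical space `ℝ³ = EuclideanSpace ℝ (Fin 3)`. -/
local notation "ℝ³" => EuclideanSpace ℝ (Fin 3)

/-! ## ns.S10: suitable weak solutions and parabolic cylinders (re-export) -/

section S10

variable {E : Type*} [NormedAddCommGroup E] [InnerProductSpace ℝ E] [FiniteDimensional ℝ E]
  [MeasurableSpace E] [BorelSpace E]

/-- **ns.S10** (suitable weak solutions and the local energy inequality; Caffarelli–Kohn–Nirenberg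
1982, §2, (2.1)–(2.5); Lin 1998, Def. 1). The accepted structure
`Fluid.IsSuitableWeakSolutionOn Q ν f u p` unfolds into the conjunction of: (i) `(u, p)` is a
distributional solution of Navier–Stokes on the open space–time region `Q`; (ii)
`u ∈ L^∞_t L²_x` locally on `Q`; (iii) `p ∈ L^{3/2}_loc(Q)`; (iv) `u` has a weak spatial gradient
`G ∈ L²_loc(Q)` satisfying the local energy inequality
`2ν ∫∫ |G|² φ ≤ ∫∫ (|u|² (φₜ + νΔφ) + (|u|² + 2p) u·∇φ + 2 (f·u) φ)` for all `0 ≤ φ ∈ C_c^∞(Q)`. [cite: Lin1998, Def. 1] -/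
theorem isSuitableWeakSolutionOn_def {Q : Opens (ℝ × E)} {ν : ℝ} {f u : ℝ → E → E}
    {p : ℝ → E → ℝ} :
    FluidPDE.IsSuitableWeakSolutionOn Q ν f u p ↔
      FluidPDE.IsDistributionalNSSolutionOn Q ν f u p ∧
      (∀ K ⊆ (Q : Set (ℝ × E)), IsCompact K → ∃ C : ℝ≥0, ∀ᵐ t : ℝ,
        ∫⁻ x, K.indicator (fun z : ℝ × E => ‖u z.1 z.2‖ₑ ^ 2) (t, x) ≤ C) ∧
      (∀ K ⊆ (Q : Set (ℝ × E)), IsCompact K →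
        ∫⁻ z in K, ‖p z.1 z.2‖ₑ ^ (3 / 2 : ℝ) < ∞) ∧
      ∃ G : ℝ → E → E →L[ℝ] E, FluidPDE.HasWeakSpatialGradientOn Q u G ∧
        (∀ K ⊆ (Q : Set (ℝ × E)), IsCompact K →
          ∫⁻ z in K, ENNReal.ofReal (FluidPDE.frobeniusNormSq (G z.1 z.2)) < ∞) ∧
        ∀ φ : ℝ → E → ℝ, FluidPDE.IsSpaceTimeTestOn Q φ → (∀ t x, 0 ≤ φ t x) →
          2 * ν * ∫ t, ∫ x, FluidPDE.frobeniusNormSq (G t x) * φ t x ≤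
            ∫ t, ∫ x, (‖u t x‖ ^ 2 * (FluidPDE.timeDeriv φ t x + ν * Δ (φ t) x) +
              (‖u t x‖ ^ 2 + 2 * p t x) * ⟪u t x, gradient (φ t) x⟫ +
              2 * ⟪f t x, u t x⟫ * φ t x) :=
  ⟨fun h => ⟨h.distributional, h.energyClass, h.pressure, h.localEnergy⟩,
    fun h => ⟨h.1, h.2.1, h.2.2.1, h.2.2.2⟩⟩

omit [InnerProductSpace ℝ E] [FiniteDimensional ℝ E] [MeasurableSpace E] [BorelSpace E] in
/-- **ns.S10** (parabolic cylinders; Caffarelli–Kohn–Nirenberg 1982, §2: `Q_r(x, t) =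
{(y, τ) : |y - x| < r, t - r² < τ < t}`). The accepted `Fluid.parabolicCylinder r (t, x)` is the
backward cylinder `(t - r², t) × B_r(x)` (definitional). [cite: CaffarelliKohnNirenberg1982, §2:  Q_r(x  t] -/
theorem parabolicCylinder_eq (r : ℝ) (z : ℝ × E) :
    FluidPDE.parabolicCylinder r z = Ioo (z.1 - r ^ 2) z.1 ×ˢ ball z.2 r :=
  rfl

omit [InnerProductSpace ℝ E] [FiniteDimensional ℝ E] [MeasurableSpace E] [BorelSpace E] in
/-- **ns.S10** (centred parabolic cylinders; Caffarelli–Kohn–Nirenberg 1982, (2.6)). The accepted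
`Fluid.parabolicCylinderCentered r (t, x)` is `Q*_r(t, x) = (t - r², t + r²) × B_r(x)`
(definitional). [cite: CaffarelliKohnNirenberg1982, (2.6] -/
theorem parabolicCylinderCentered_eq (r : ℝ) (z : ℝ × E) :
    FluidPDE.parabolicCylinderCentered r z = Ioo (z.1 - r ^ 2) (z.1 + r ^ 2) ×ˢ ball z.2 r :=
  rfl

end S10

/-! ## ns.S11, ns.S12: the Caffarelli–Kohn–Nirenberg theorems -/

section CKN

/-- **CKN force class** on an open space–time region `Q ⊆ ℝ × ℝ³` (Caffarelli–Kohn–Nirenberg 1982,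
(2.3′)): `f ∈ L^q(Q)` for some real `q > 5/2`, and `div f = 0` in `Q` in the sense of
distributions (`∫∫ ⟪f, ∇φ⟫ = 0` for every real space–time test function `φ ∈ C_c^∞(Q)`). These
are the standing hypotheses on the force in CKN's Proposition 2 and Theorem B (Lin 1998 takes
`f = 0`, cf. `isCKNForceOn_zero`). [cite: Lin1998, takes  f = 0   cf.  isCKNForceOn_zero] -/
def IsCKNForceOn (Q : Opens (ℝ × ℝ³)) (f : ℝ → ℝ³ → ℝ³) : Prop :=
  (∃ q : ℝ, 5 / 2 < q ∧
    MemLp (uncurry f) (ENNReal.ofReal q) (volume.restrict (Q : Set (ℝ × ℝ³)))) ∧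
  ∀ φ : ℝ → ℝ³ → ℝ, FluidPDE.IsSpaceTimeTestOn Q φ → ∫ t, ∫ x, ⟪f t x, gradient (φ t) x⟫ = 0

/-- The zero force is a CKN force on every region (take `q = 3`; Lin 1998). [cite: Lin1998] -/
theorem isCKNForceOn_zero (Q : Opens (ℝ × ℝ³)) : IsCKNForceOn Q 0 := by
  refine ⟨⟨3, by norm_num, ?_⟩, fun φ _ => by simp⟩
  exact (MemLp.zero : MemLp (0 : ℝ × ℝ³ → ℝ³) (ENNReal.ofReal 3)
    (volume.restrict (Q : Set (ℝ × ℝ³))))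

/-- **ns.S11** (Caffarelli–Kohn–Nirenberg partial regularity; CKN 1982, Theorem B: "For any
suitable weak solution of the Navier–Stokes system on an open set in space–time, the associated
singular set satisfies `𝒫¹(S) = 0`"; new proof in Lin 1998). Let `(u, p)` be a suitable weak
solution with viscosity `ν > 0` on the open region `Q ⊆ ℝ × ℝ³`, with force `f ∈ L^q(Q)`,
`q > 5/2`, `div f = 0` (CKN (2.3′)). Then the singular set
`S = {z ∈ Q | u ∉ L^∞ near z}` (`Fluid.singularSet u Q`) has one-dimensional parabolic Hausdorff
measure zero. (CKN normalise `ν = 1`; the general case is the rescaling `u(t, x) ↦ ν⁻¹… `, under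
which `𝒫¹`-null sets are preserved.) [cite: CKN1982, Theorem B: "For any suitable weak soluti] -/
def ckn_partial_regularity : Prop :=
  ∀ (Q : Opens (ℝ × ℝ³)) {ν : ℝ} (hν : 0 < ν) {f u : ℝ → ℝ³ → ℝ³} {p : ℝ → ℝ³ → ℝ} (h : FluidPDE.IsSuitableWeakSolutionOn Q ν f u p) (hf : IsCKNForceOn Q f),
    FluidPDE.IsParabolicNull 1 (FluidPDE.singularSet u (Q : Set (ℝ × ℝ³)))

/-- **ns.S12** (ε-regularity criterion; Caffarelli–Kohn–Nirenberg 1982, Proposition 2; Lin 1998,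
Thm 1.1). There is an absolute constant `ε > 0` with the following property. If `(u, p)` is a
suitable weak solution of the Navier–Stokes system (`ν = 1`) on an open region `Q ⊆ ℝ × ℝ³` with a
CKN force `f`, `G` is a weak spatial gradient of `u` on `Q` (i.e. `G = ∇u`), `z ∈ Q`, and
`limsup_{r → 0⁺} r⁻¹ ∫∫_{Q*_r(z)} |∇u|² ≤ ε`
(centred cylinders `Q*_r(z) = (t - r², t + r²) × B_r(x)`, as in CKN's Proposition 2), then `z` is
a regular point of `u`, i.e. `u` is essentially bounded on some `Q*_ρ(z)`. [cite: CaffarelliKohnNirenberg1982, Proposition 2] -/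
def ckn_epsilon_regularity : Prop :=
  ∃ ε : ℝ, 0 < ε ∧ ∀ (Q : Opens (ℝ × ℝ³)) (f u : ℝ → ℝ³ → ℝ³) (p : ℝ → ℝ³ → ℝ),
      FluidPDE.IsSuitableWeakSolutionOn Q 1 f u p → IsCKNForceOn Q f →
      ∀ z ∈ Q, (∀ G : ℝ → ℝ³ → ℝ³ →L[ℝ] ℝ³, FluidPDE.HasWeakSpatialGradientOn Q u G →
        limsup (fun r : ℝ => (ENNReal.ofReal r)⁻¹ *
          ∫⁻ q in FluidPDE.parabolicCylinderCentered r z,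
            ENNReal.ofReal (FluidPDE.frobeniusNormSq (G q.1 q.2))) (𝓝[>] (0 : ℝ)) ≤
          ENNReal.ofReal ε) →
      FluidPDE.IsRegularPoint u z

end CKN

/-! ## ns.S23 vocabulary: centred Type I points and Type I ancient solutions (open statements)

The named fact `albritton_barker` (Albritton–Barker 2019, Thm 1.1) formerly closing this section
was retired as misstated on 2026-08-14; the corrected rendering is
`Literature.Analysis.FluidPDE.AlbrittonBarkerTypeICharacterization` in `LocalTypeI.lean` (see
the module docstring, "Retired and re-labelled"). -/

section AlbrittonBarker

/-- The sum `A + C + D + E` of the **accepted** CKN-type scaled quantities at scale `r` and centre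
`z = (t, x)`: `A(r) = sup_{t-r²<t'<t} r⁻¹ ∫_{B_r(x)} |u(t')|²` (`Fluid.cknA`, a genuine supremum),
`C(r) = r⁻² ∫∫_{Q_r(z)} |u|³` (`Fluid.cknC`), `D(r) = r⁻² ∫∫_{Q_r(z)} |p|^{3/2}` (`Fluid.cknD`),
`E(r) = r⁻¹ ∫∫_{Q_r(z)} |∇u|²` (`Fluid.cknE`, `G` standing for `∇u`), in `ℝ≥0∞`. These are the
quantities displayed in Albritton–Barker 2019, §1 after Thm 1.1, except that the paper takes
`esssup_t` in `A` and the mean-free pressure `|q - [q]_{x,r}(t')|^{3/2}` in `D`; that printed sum is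
`Literature.Analysis.FluidPDE.abScaledSum` (`LocalTypeI.lean`).
[cite: AlbrittonBarker2019, §1 (displays defining A, C, D, E after Thm 1.1; variant)] -/
def cknSum (r : ℝ) (z : ℝ × ℝ³) (u : ℝ → ℝ³ → ℝ³) (p : ℝ → ℝ³ → ℝ)
    (G : ℝ → ℝ³ → ℝ³ →L[ℝ] ℝ³) : ℝ≥0∞ :=
  FluidPDE.cknA r z u + FluidPDE.cknC r z u + FluidPDE.cknD r z p + FluidPDE.cknE r z G

/-- Unfolding `cknSum`. [folklore] -/
theorem cknSum_def (r : ℝ) (z : ℝ × ℝ³) (u : ℝ → ℝ³ → ℝ³) (p : ℝ → ℝ³ → ℝ)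
    (G : ℝ → ℝ³ → ℝ³ →L[ℝ] ℝ³) :
    cknSum r z u p G = FluidPDE.cknA r z u + FluidPDE.cknC r z u + FluidPDE.cknD r z p + FluidPDE.cknE r z G :=
  rfl

/-- **Type I singular points, centred form**: `z` is a singular point (accepted, centred
cylinders: `z ∈ Fluid.singularSet u Q`) of the suitable weak solution `(u, p)` of the unforced
Navier–Stokes system (`ν = 1`) on the open region `Q ⊆ ℝ × ℝ³`, and for some `r₀ > 0` with
`Q_{r₀}(z) ⊆ Q` the accepted scale-invariant quantities stay bounded down to `r = 0` **at the
cylinders centred at `z`**: `sup_{0 < r < r₀} (A + C + D + E)(r, z) < ∞` (`cknSum`), `∇u` being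
represented by a weak spatial gradient `G` of `u` on `Q`. This is a Type I notion in the sense of
Seregin–Šverák 2009, §1 ("Singularities for which some scale-invariant quantity is bounded are
often called Type I singularities", the quantities `X(z₀, R; v)` listed there being centred at the
point). It is NOT the Type I notion of Albritton–Barker 2019, §1 — there `𝐈(Q') < ∞` bounds
`A + C + D + E` over *all* parabolic sub-balls of a ball `Q'` centred at `z`, with `esssup_t` in
`A`, mean-free pressure in `D` and backward balls in the notion of singular point; that notion is
`Literature.Analysis.FluidPDE.IsLocalTypeISingularPoint` (`LocalTypeI.lean`).
[cite: SereginSverak2009, §1 (Type I = some scale-invariant quantity bounded at the point)] -/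
def IsTypeISingularPoint (Q : Opens (ℝ × ℝ³)) (u : ℝ → ℝ³ → ℝ³) (p : ℝ → ℝ³ → ℝ)
    (z : ℝ × ℝ³) : Prop :=
  FluidPDE.IsSuitableWeakSolutionOn Q 1 0 u p ∧ z ∈ FluidPDE.singularSet u (Q : Set (ℝ × ℝ³)) ∧
    ∃ G : ℝ → ℝ³ → ℝ³ →L[ℝ] ℝ³, FluidPDE.HasWeakSpatialGradientOn Q u G ∧
      ∃ r₀ : ℝ, 0 < r₀ ∧ FluidPDE.parabolicCylinder r₀ z ⊆ Q ∧
        (⨆ r ∈ Ioo 0 r₀, cknSum r z u p G) < ∞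

/-- OPEN CONJECTURE — registered open statement (an open existence *question*; nobody asserts it
in print): **a suitable weak solution with a (centred) Type I singular point exists** — there are
an open region `Q ⊆ ℝ × ℝ³` and a suitable weak solution `(u, p)` of the unforced Navier–Stokes
system (`ν = 1`) on `Q` with a point `z` satisfying `IsTypeISingularPoint Q u p z`. This
transcribes the first bullet of Albritton–Barker 2019, Thm 1.1 ("There exists a suitable weak
solution with Type I singular point") onto the accepted centred notion (see
`IsTypeISingularPoint` for the discrepancy with the printed one, `LocalTypeISingularityExists` of
`LocalTypeI.lean`). The paper asserts only an *equivalence* of its first bullet with the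
existence of Type I ancient solutions, never the bullet itself; whether (Type I) singular points
of suitable weak solutions of the unforced equations occur at all is open ("many questions
concerning feasible Type I scenarios, e.g., discretely self-similar blow-up, remain completely
open", A–B §1; under the Liouville conjecture (L) of Koch–Nadirashvili–Seregin–Šverák 2009 Type I
singularities in Albritton–Barker's sense do not occur: "If true, the conjecture excludes Type I
singularities", A–B §1). Registered here as an open statement (CONVENTIONS §4), not literature
debt: no `TypeISingularityExists_holds` is to be expected; the name is kept (it was the
left-hand side of the retired `albritton_barker` and is quoted in the `TypeILiouville` route).
[cite: AlbrittonBarker2019, Thm 1.1 (first bullet); §1 (Type I scenarios open)] [status: open] -/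
@[conjecture] def TypeISingularityExists : Prop :=
  ∃ (Q : Opens (ℝ × ℝ³)) (u : ℝ → ℝ³ → ℝ³) (p : ℝ → ℝ³ → ℝ) (z : ℝ × ℝ³),
    IsTypeISingularPoint Q u p z

/-- OPEN CONJECTURE — registered open statement, expected to be **false** under the Liouville
conjecture (L) of Koch–Nadirashvili–Seregin–Šverák 2009: **a non-trivial mild bounded ancient
solution with Type I decay exists** — there is a mild bounded ancient solution `u` of
Navier–Stokes on `(-∞, 0) × ℝ³` (`ν = 1`; KNSS 2009, §1; `Fluid.IsBoundedAncientMildSolution`)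
which is *nontrivial* (not a.e. zero on `(-∞, 0) × ℝ³`) and satisfies the Type I bound
`sup_{r > 0, z ∈ (-∞, 0) × ℝ³} (A + C + D + E)(r, z) < ∞` (`cknSum`, accepted quantities: `sup_t`
in `A`, `|p|^{3/2}` in `D`), where `p` is a pressure for which `(u, p)` is a suitable weak
solution on `(-∞, 0) × ℝ³` and `G` is a weak spatial gradient of `u` there. This transcribes the
second bullet of Albritton–Barker 2019, Thm 1.1 ("There exists a non-trivial mild bounded
ancient solution with `𝐈 < ∞`") onto the accepted quantities (the printed `𝐈`, with `esssup_t`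
and mean-free pressure, gives `NontrivialMildAncientTypeIExists` of `LocalTypeI.lean`). The paper
asserts only the *equivalence* of this bullet with the existence of a Type I singular point,
never the bullet itself: it is open ("In principle, constructing ancient solutions with Type I
decay is a (difficult) route to obtaining Navier–Stokes singularities", A–B §1), and (L) would
refute it ("Together, `v ≡ const.` and `𝐈 < ∞` imply `v ≡ 0`"; "If true, the conjecture
excludes Type I singularities", A–B §1; in tree, up to a slice-measurability proviso:
`LiouvilleConjectureNS.not_nontrivialTypeIAncientExists_measurable`,
`TypeIAncientLiouville.lean`). Registered here as an open statement (CONVENTIONS §4), not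
literature debt: no `NontrivialTypeIAncientExists_holds` is to be expected; users keep the
explicit hypothesis `(h : NontrivialTypeIAncientExists)`. The name is kept (used by
`TypeIAncientLiouville.lean`) rather than renamed `…Conjecture`.
[cite: AlbrittonBarker2019, Thm 1.1 (second bullet) and §1 (open; refuted by (L))] [status: open] -/
@[conjecture] def NontrivialTypeIAncientExists : Prop :=
  ∃ (u : ℝ → ℝ³ → ℝ³) (p : ℝ → ℝ³ → ℝ) (G : ℝ → ℝ³ → ℝ³ →L[ℝ] ℝ³),
    FluidPDE.IsBoundedAncientMildSolution 1 u ∧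
    FluidPDE.IsSuitableWeakSolutionOn (FluidPDE.slab ℝ³ (Iio 0) isOpen_Iio) 1 0 u p ∧
    FluidPDE.HasWeakSpatialGradientOn (FluidPDE.slab ℝ³ (Iio 0) isOpen_Iio) u G ∧
    ¬ (uncurry u =ᵐ[volume.restrict (Iio (0 : ℝ) ×ˢ (univ : Set ℝ³))] 0) ∧
    (⨆ (r : ℝ) (_ : 0 < r) (z : ℝ × ℝ³) (_ : z.1 < 0), cknSum r z u p G) < ∞

end AlbrittonBarker

/-! ## ns.S32: Tao's quantitative Escauriaza–Seregin–Šverák theorem -/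

section Tao

/-- **Tao's classical solutions** (Tao 2021, §1: smooth solutions of the unforced Navier–Stokes
system, `ν = 1`, on `S × ℝ³` all of whose spatial derivatives lie in `L^∞_t L²_x`): `(u, p)` is a
classical solution on the time set `S` (`Fluid.IsClassicalNSSolutionOn S 1 0 u p`) and, for every
order `n`, `sup_{t ∈ S} ‖∇ⁿ u(t)‖_{L²(ℝ³)} < ∞`. For such solutions the pressure is
`-Δ⁻¹ ∂ᵢ∂ⱼ(uᵢuⱼ)` up to an (irrelevant) function of time. [cite: Tao2021, §1: smooth solutions of the unforced Nav] -/
def IsHkClassicalSolutionOn (S : Set ℝ) (u : ℝ → ℝ³ → ℝ³) (p : ℝ → ℝ³ → ℝ) : Prop :=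
  FluidPDE.IsClassicalNSSolutionOn S 1 0 u p ∧
    ∀ n : ℕ, ∃ C : ℝ≥0, ∀ t ∈ S, eLpNorm (iteratedFDeriv ℝ n (u t)) 2 volume ≤ C

/-- A Tao classical solution is a classical solution (projection). [folklore] -/
theorem IsHkClassicalSolutionOn.isClassicalNSSolutionOn {S : Set ℝ} {u : ℝ → ℝ³ → ℝ³}
    {p : ℝ → ℝ³ → ℝ} (h : IsHkClassicalSolutionOn S u p) :
    FluidPDE.IsClassicalNSSolutionOn S 1 0 u p :=
  h.1

/-- Tao classical solutions restrict to smaller time sets on which the one-sided time derivative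
is unchanged (Mathlib `UniqueDiffOn`; e.g. `Icc 0 T' ⊆ Icc 0 T`). [folklore] -/
theorem IsHkClassicalSolutionOn.mono {S S' : Set ℝ} {u : ℝ → ℝ³ → ℝ³} {p : ℝ → ℝ³ → ℝ}
    (h : IsHkClassicalSolutionOn S u p) (hS' : S' ⊆ S) (hU : UniqueDiffOn ℝ S') :
    IsHkClassicalSolutionOn S' u p :=
  ⟨h.1.mono hS' hU, fun n => (h.2 n).imp fun _ hC t ht => hC t (hS' ht)⟩

/-- The triple exponential `exp exp exp (A ^ C)` of Tao 2021, Thm 1.2. [cite: Tao2021, Thm 1.2] -/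
def taoTripleExp (C A : ℝ) : ℝ :=
  Real.exp (Real.exp (Real.exp (A ^ C)))

/-- Unfolding `taoTripleExp`. [folklore] -/
theorem taoTripleExp_def (C A : ℝ) :
    taoTripleExp C A = Real.exp (Real.exp (Real.exp (A ^ C))) :=
  rfl

/-- The triple exponential is positive. [folklore] -/
theorem taoTripleExp_pos (C A : ℝ) : 0 < taoTripleExp C A :=
  Real.exp_pos _

/-- **ns.S32** (quantitative Escauriaza–Seregin–Šverák; Tao 2021, Thm 1.2, cases `j = 0, 1`).
There is an absolute constant `C > 0` such that: if `(u, p)` is a classical solution of the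
unforced Navier–Stokes system on `[0, T] × ℝ³` (in Tao's class `IsHkClassicalSolutionOn`) with
the critical bound `‖u‖_{L^∞_t L³_x([0, T] × ℝ³)} ≤ A` for some `A ≥ 2`, then for all
`0 < t ≤ T` and `x ∈ ℝ³`,
`|u(t, x)| ≤ exp exp exp (A^C) · t^{-1/2}` and `|∇u(t, x)| ≤ exp exp exp (A^C) · t^{-1}`.
The `L^∞_t L³_x` bound is imposed for every `t ∈ [0, T]` (equivalently, for a.e. `t`, by lower
semicontinuity of `t ↦ ‖u(t)‖₃` for such solutions). [cite: Tao2021, Thm 1.2  cases  j = 0  1] -/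
def tao_quantitative_ess : Prop :=
  ∃ C : ℝ, 0 < C ∧ ∀ (T A : ℝ) (u : ℝ → ℝ³ → ℝ³) (p : ℝ → ℝ³ → ℝ),
      IsHkClassicalSolutionOn (Icc 0 T) u p →
      (∀ t ∈ Icc 0 T, eLpNorm (u t) 3 volume ≤ ENNReal.ofReal A) → 2 ≤ A →
      ∀ t ∈ Ioc 0 T, ∀ x : ℝ³,
        ‖u t x‖ ≤ taoTripleExp C A * t ^ (-(1 / 2 : ℝ)) ∧
        ‖fderiv ℝ (u t) x‖ ≤ taoTripleExp C A * t ^ (-(1 : ℝ))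

/-- **ns.S32** (triple-logarithmic lower bound on the `L³` blow-up rate; Tao 2021, Thm 1.4).
There is an absolute constant `c > 0` such that: if `(u, p)` is a classical solution of the
unforced Navier–Stokes system on `[0, T) × ℝ³`, `T > 0` (in Tao's class on every `[0, T']`,
`T' < T`), which blows up at time `T` (`‖u‖_{L^∞([0, T) × ℝ³)} = ∞`), then
`limsup_{t → T⁻} ‖u(t)‖_{L³(ℝ³)} / (log log log (T - t)⁻¹)^c = +∞`, i.e. for every `M` there are
times `t < T` arbitrarily close to `T` with `‖u(t)‖₃ > M (log log log (T - t)⁻¹)^c`. [cite: Tao2021, Thm 1.4] -/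
def tao_L3_blowup_rate : Prop :=
  ∃ c : ℝ, 0 < c ∧ ∀ (T : ℝ) (u : ℝ → ℝ³ → ℝ³) (p : ℝ → ℝ³ → ℝ), 0 < T →
      (∀ T' ∈ Ioo 0 T, IsHkClassicalSolutionOn (Icc 0 T') u p) →
      ¬ FluidPDE.IsBoundedOn (Ico 0 T) u →
      ∀ M : ℝ, ∃ᶠ t in 𝓝[<] T,
        ENNReal.ofReal (M * Real.log (Real.log (Real.log (T - t)⁻¹)) ^ c) <
          eLpNorm (u t) 3 volume

end Tao

end Literature.Analysis.FluidPDE
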